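import Literature.MathematicalPhysics.QuantumFieldTheory.Balaban1983to89.B1Sect3Statements

/-!
# `Balaban1983to89.B1Ineq351Proof` — T. Bałaban, *(Higgs)₂,₃ quantum fields in a finite volume. I. A lower bound*,
Commun. Math. Phys. **85** (1982) 603–626 [Balaban1982Higgs1]: the step **(3.38) ⇒ (3.51)** pp. 619–621 — the translations
(3.41) `A = A′ + aL⁻²C^{(k)}Q*B` and (3.48) `φ = φ′ + aL⁻²C^{(k)}(B^{(k+1)})Q*(B^{(k+1)})ψ` performed UNDER THE INTEGRAL (3.38)
(Gaussian completing of the square `B1Sect3Statements.Split311` + translation invariance of the field-space Lebesgue measure: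
the quadratic forms come out as `exp(−½⟨B, Δ^{(k+1),L}B⟩ − ½⟨ψ, Δ^{(k+1),L}(B^{(k+1)})ψ⟩)`), followed by *"we estimate the
integral (3.38) from below introducing the characteristic functions"* (3.43)/(3.50) (insertion of `0 ≤ χ ≤ 1` against a
non-negative integrand) — PROVED over an abstract translation-invariant measure; the same mechanism gives (3.7) ⇒ (3.22)
p. 616 (first step) and the Gaussian factor of (2.17) p. 610; theorems only

statement-level skeleton of published theorems with citation tags; proofs where landed; nothing here is a claim about the Yang–Mills mass gap

PDF held: `paper:balaban1982-cmp85-higgs23-i` (journal page = PDF page + 602); (3.38)–(3.43) p. 619 and (3.48)–(3.51) p. 621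
READ AS IMAGES on the x2 renders `run/shared/lean/pub/pub-balaban/b2b-balaban-ref1/pages/1982-cmp85-higgs23-I/…-p017-x2.png`,
`…-p019-x2.png`.

CITATION HEADER (lean-in-tree rule).  WHAT IS REPRODUCED — SKELETON row **B1.Eq3.51** (reader r12
`lit-balaban-r12/ROWS-B1-part2.md`: «(3.38) ≥ const Z_kZ_k(B^{(k+1)})exp(−½⟨B,Δ^{(k+1),L}B⟩ − ½⟨ψ,Δ^{(k+1),L}(B^{(k+1)})ψ⟩)
χ_{k+1}χ_{k+1}∫dA′∫dφ′ χ_k(A′+…)χ_k(φ′+…)χ(A′)χ(φ′)exp[−½⟨A′,(C^{(k)})⁻¹A′⟩ − ½⟨φ′,(C^{(k)}(B^{(k+1)}))⁻¹φ′⟩ + V^{(k)} − E₀ +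
O(1)(L^kε)^κ∣T₁^{(k)}∣]; absent · integral inequality (assembly of (3.41)–(3.50))»).  Verbatim, p. 619 [PDF 17]: *"The next
operation is a translation in the fields A and an expansion of the action with respect to a small field produced by the
translation. This translation has the form A = A′ + aL⁻²C^{(k)}Q*B (3.41) and it separates the quadratic form in the fields
A, B in the exponential function under the integral (3.38) into a sum of the forms ½⟨B, Δ^{(k+1),L}B⟩ + ½⟨A′, (C^{(k)})⁻¹A′⟩.
… We estimate the integral (3.38) from below introducing the characteristic functions χ(A′) = Π_{x∈T₁^{(k)}} χ({|A′(x)| ≤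
p₁(L^kε)}), (3.43)"*; p. 621 [PDF 19]: *"Now we will do a translation in the fields φ. The translation has the form φ = φ′ +
aL⁻²C^{(k)}(B^{(k+1)})Q*(B^{(k+1)})ψ, (3.48) and it separates again the basic quadratic form for scalar fields into a sum of the
corresponding forms in the fields ψ and φ′. The rest of the action changes in an obvious manner. … Finally we estimate from
below the integral introducing the characteristic functions χ(φ′) = Π_{x∈T₁^{(k)}} χ({|φ′(x)| ≤ p₁(L^kε)}). (3.50) … After these
operations and estimates we have the inequality (3.38) ≥ const Z_kZ_k(B^{(k+1)})exp(−½⟨B, Δ^{(k+1),L}B⟩ − ½⟨ψ,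
Δ^{(k+1),L}(B^{(k+1)})ψ⟩)·χ_{k+1}(B)χ_{k+1}(ψ)·∫dA′∫dφ′ χ_k(A′ + aL⁻²C^{(k)}Q*B)χ_k(φ′ + aL⁻²C^{(k)}(B^{(k+1)})Q*(B^{(k+1)})ψ)
·χ(A′)χ(φ′)exp[−½⟨A′, (C^{(k)})⁻¹A′⟩ − ½⟨φ′, (C^{(k)}(B^{(k+1)}))⁻¹φ′⟩ + V^{(k)}(B^{(k+1)}, ψ, A′^{(k)}, φ′) − E₀ + O(1)(L^kε)^κ
|T₁^{(k)}|]. (3.51)"*.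

THE MODEL (schematic, as in the siblings `B1Ineq352Proof`/`B1Ineq353Proof`/`B1Eq314Proof`): the field spaces are abstract real
vector spaces `E` (↤ the vector fields `A` on `T₁^{(k)}`), `F` (↤ the scalar fields `φ`) carrying translation-invariant measures
`μ`, `ν` (↤ the Lebesgue measures `dA`, `dφ` of (3.38); concrete instance: `volume` on `X → ℝ^N`, an additive Haar measure);
`U`, `W` ↤ the block fields `B`, `ψ`; the quadratic forms are arguments related by the HYPOTHESIS `B1Sect3Statements.Split311`
((3.11)/(3.19)/the sentences after (3.41) and (3.48): `qAB (A′ + cC Q*B) B = qB B + qA′ A′` — proved for the completing-the-square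
data by `B1Eq314Proof.split311_of_minimiser`, and on `B1RG242.StepData` by `split311_stepData`), with `qAB A B` ↤ `½aL^{d−2}Σ|B −
QA|² + ½⟨A, Δ^{(k)}A⟩`, `qB B` ↤ `½⟨B, Δ^{(k+1),L}B⟩`, `qA′ A′` ↤ `½⟨A′, (C^{(k)})⁻¹A′⟩`, and the scalar twins at the background
`B^{(k+1)}`; EVERYTHING ELSE under the integral (3.38) (`log Z_k + log Z_k(A^{(k)}) + 𝒫^{(k)} − E₀`, the characteristic functions
`χ_k(A)χ_k(φ)`, the difference between the scalar form at `A^{(k)}` and at `B^{(k+1)}`) is an arbitrary non-negative factor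
`G A φ` — so the exponent bookkeeping of (3.51) (`V^{(k)}`, `Z_kZ_k(B^{(k+1)})` via (3.46)–(3.47), `O(1)(L^kε)^κ|T₁^{(k)}|` via
Prop. 3.1) rides inside `G` and a prefactor `K ≥ 0` (↤ `const·χ_{k+1}(B)χ_{k+1}(ψ)`), displayed, not derived.

WHAT THIS FILE PROVES (theorems only — no `def`, no new `Prop` fact; 0 `sorry`; standard axioms):
* `integral_comp_transl310` — the change of variables (3.41)/(3.48) costs nothing: `∫dA′ F(A′ + cCQ*B) = ∫dA F(A)` for a
  translation-invariant measure;
* **`integral_gauss_translate`** — THE MECHANISM: `Split311 c C Q* qAB qB qA′` ⇒ `∫dA e^{−qAB(A,B)}G(A) = e^{−qB(B)}∫dA′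
  e^{−qA′(A′)}G(A′ + cCQ*B)` (the sentences after (3.41) and (3.48); also (3.7) ⇒ (3.22) p. 616 and the Gaussian factor of
  (2.17) p. 610); `integral_gauss_translate₂` — both fields, iterated integral: the factor `e^{−½⟨B,ΔB⟩ − ½⟨ψ,Δ(B)ψ⟩}` of (3.51);
* `integral_insert_cutoff_le` — *"we estimate the integral from below introducing the characteristic functions"*: `∫χ·f ≤ ∫f`
  for `0 ≤ χ ≤ 1`, `f ≥ 0` integrable;
* **`ineq351`** — (3.38) ⇒ (3.51): `K·e^{−qB(B)}e^{−qψ(ψ)}·∫dA′ χ(A′)e^{−qA′(A′)}∫dφ′ χ(φ′)e^{−qφ′(φ′)}G(A′ + …B, φ′ + …ψ) ≤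
  K·∫dA e^{−qAB(A,B)}∫dφ e^{−qφψ(φ,ψ)}G(A,φ)` (`ineq351_one` the one-field version).
HONEST SCOPE.  Kernel-checked: the measure-theoretic skeleton (translation, factorisation of the block-field Gaussians,
monotonicity).  Not derived here: the splitting hypotheses (see `B1Eq314Proof`), the form of the exponent of (3.51) and
its constants (rows B1.Eq3.44–3.47, B1.Prop3.1), the redundancy of the `χ_k`'s (`B1Ineq353Proof`, (3.51) ⇒ (3.55)).
Unit `lit-balaban-p14` gen 3 (Phase-2 proof seat p14, literature-prover-lit-balaban-p14-g3-0), HOME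
`run/shared/lean/pub/lit-balaban/` (seat log `lit-balaban-p14/STATUS.md`).
-/

namespace Literature.MathematicalPhysics.QuantumFieldTheory.Balaban1983to89.B1Ineq351Proof

open Literature.MathematicalPhysics.QuantumFieldTheory.Balaban1983to89
open B1Sect3Statements MeasureTheory

/-! ## §1 One field: translation (3.41)/(3.48) under the integral -/

section OneField

variable {E U : Type*} [AddCommGroup E] [Module ℝ E] [AddCommGroup U] [Module ℝ U]
  [MeasurableSpace E] [MeasurableAdd E] (μ : Measure E) [μ.IsAddLeftInvariant]

/-- The change of variables (3.41) `A = A′ + aL⁻²C^{(k)}Q*B` (resp. (3.48)) under a translation-invariant measure `dA`: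
`∫dA′ F(A′ + cC Q*B) = ∫dA F(A)` (`B1Sect3Statements.transl310 c C Q* A′ B = A′ + c·C(Q*B)`).
[cite: Balaban1982Higgs1, (3.41) p.619] -/
theorem integral_comp_transl310 (c : ℝ) (C : E →ₗ[ℝ] E) (Qstar : U →ₗ[ℝ] E) (B : U) (F : E → ℝ) :
    ∫ A', F (transl310 c C Qstar A' B) ∂μ = ∫ A, F A ∂μ := by
  have h : ∀ A', transl310 c C Qstar A' B = c • C (Qstar B) + A' := fun A' => by rw [transl310, add_comm]
  simp_rw [h]
  exact integral_add_left_eq_self F _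

/-- **THE MECHANISM of (3.38) ⇒ (3.51) (and of (3.7) ⇒ (3.22), (2.17))**: if the quadratic form splits under the translation
(`Split311 c C Q* qAB qB qA′`: `qAB(A′ + cCQ*B, B) = qB(B) + qA′(A′)` — *"it separates the quadratic form in the fields A, B in
the exponential function under the integral (3.38) into a sum of the forms ½⟨B, Δ^{(k+1),L}B⟩ + ½⟨A′, (C^{(k)})⁻¹A′⟩"*), then for
every other factor `G` of the integrand `∫dA e^{−qAB(A,B)}G(A) = e^{−qB(B)}·∫dA′ e^{−qA′(A′)}G(A′ + cCQ*B)`.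
[cite: Balaban1982Higgs1, (3.41) p.619] -/
theorem integral_gauss_translate {c : ℝ} {C : E →ₗ[ℝ] E} {Qstar : U →ₗ[ℝ] E} {qAB : E → U → ℝ} {qB : U → ℝ}
    {qA' : E → ℝ} (hsplit : Split311 c C Qstar qAB qB qA') (B : U) (G : E → ℝ) :
    ∫ A, Real.exp (-qAB A B) * G A ∂μ
      = Real.exp (-qB B) * ∫ A', Real.exp (-qA' A') * G (transl310 c C Qstar A' B) ∂μ := by
  have key := integral_comp_transl310 μ c C Qstar B (fun A => Real.exp (-qAB A B) * G A)
  calc ∫ A, Real.exp (-qAB A B) * G A ∂μ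
      = ∫ A', Real.exp (-qAB (transl310 c C Qstar A' B) B) * G (transl310 c C Qstar A' B) ∂μ := key.symm
    _ = ∫ A', Real.exp (-qB B) * (Real.exp (-qA' A') * G (transl310 c C Qstar A' B)) ∂μ := by
        refine integral_congr_ae (Filter.Eventually.of_forall fun A' => ?_)
        show Real.exp (-qAB (transl310 c C Qstar A' B) B) * G (transl310 c C Qstar A' B)
          = Real.exp (-qB B) * (Real.exp (-qA' A') * G (transl310 c C Qstar A' B))
        rw [hsplit A' B, neg_add, Real.exp_add]
        ring
    _ = Real.exp (-qB B) * ∫ A', Real.exp (-qA' A') * G (transl310 c C Qstar A' B) ∂μ := integral_const_mul _ _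

omit [AddCommGroup E] [Module ℝ E] [MeasurableAdd E] [μ.IsAddLeftInvariant] in
/-- *"We estimate the integral (3.38) from below introducing the characteristic functions"* (3.43) p. 619 / (3.50) p. 621:
inserting a factor `χ` with `0 ≤ χ ≤ 1` into a non-negative integrable integrand can only decrease the integral.
[cite: Balaban1982Higgs1, (3.43) p.619] -/
theorem integral_insert_cutoff_le {f χ : E → ℝ} (hf : Integrable f μ) (hf0 : ∀ A, 0 ≤ f A) (hχ0 : ∀ A, 0 ≤ χ A)
    (hχ1 : ∀ A, χ A ≤ 1) : ∫ A, χ A * f A ∂μ ≤ ∫ A, f A ∂μ :=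
  integral_mono_of_nonneg (Filter.Eventually.of_forall fun A => mul_nonneg (hχ0 A) (hf0 A)) hf
    (Filter.Eventually.of_forall fun A => mul_le_of_le_one_left (hf0 A) (hχ1 A))

/-- (3.38) ⇒ (3.51) for ONE field (the vector field, say): translation + cut-off insertion,
`e^{−qB(B)}·∫dA′ χ(A′)e^{−qA′(A′)}G(A′ + cCQ*B) ≤ ∫dA e^{−qAB(A,B)}G(A)` for `G ≥ 0`, `0 ≤ χ ≤ 1`, the translated integrand
integrable. [cite: Balaban1982Higgs1, (3.51) p.621] -/
theorem ineq351_one {c : ℝ} {C : E →ₗ[ℝ] E} {Qstar : U →ₗ[ℝ] E} {qAB : E → U → ℝ} {qB : U → ℝ} {qA' : E → ℝ}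
    (hsplit : Split311 c C Qstar qAB qB qA') (B : U) {G : E → ℝ} (hG : ∀ A, 0 ≤ G A) {χ : E → ℝ}
    (hχ0 : ∀ A, 0 ≤ χ A) (hχ1 : ∀ A, χ A ≤ 1)
    (hint : Integrable (fun A' => Real.exp (-qA' A') * G (transl310 c C Qstar A' B)) μ) :
    Real.exp (-qB B) * ∫ A', χ A' * (Real.exp (-qA' A') * G (transl310 c C Qstar A' B)) ∂μ
      ≤ ∫ A, Real.exp (-qAB A B) * G A ∂μ := by
  rw [integral_gauss_translate μ hsplit B G]
  exact mul_le_mul_of_nonneg_left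
    (integral_insert_cutoff_le μ hint (fun A' => mul_nonneg (Real.exp_nonneg _) (hG _)) hχ0 hχ1) (Real.exp_nonneg _)

end OneField

/-! ## §2 Both fields: the iterated integral (3.38) and the inequality (3.51) -/

section TwoFields

variable {E U F W : Type*} [AddCommGroup E] [Module ℝ E] [AddCommGroup U] [Module ℝ U]
  [AddCommGroup F] [Module ℝ F] [AddCommGroup W] [Module ℝ W]
  [MeasurableSpace E] [MeasurableAdd E] (μ : Measure E) [μ.IsAddLeftInvariant]
  [MeasurableSpace F] [MeasurableAdd F] (ν : Measure F) [ν.IsAddLeftInvariant]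

/-- **Both translations under the double integral (3.38)**: with the vector-field splitting ((3.41): `qAB(A′ + c_AC_AQ*_AB, B) =
qB(B) + qA′(A′)`) and the scalar-field splitting at the background `B^{(k+1)}` ((3.48): `qφψ(φ′ + c_φC_φQ*_φψ, ψ) = qψ(ψ) +
qφ′(φ′)`), `∫dA e^{−qAB(A,B)}∫dφ e^{−qφψ(φ,ψ)}G(A,φ) = e^{−qB(B)}e^{−qψ(ψ)}·∫dA′ e^{−qA′(A′)}∫dφ′ e^{−qφ′(φ′)}G(A′ + c_AC_AQ*_AB, φ′ +
c_φC_φQ*_φψ)` — the factor `exp(−½⟨B, Δ^{(k+1),L}B⟩ − ½⟨ψ, Δ^{(k+1),L}(B^{(k+1)})ψ⟩)` of (3.51) and the Gaussian weights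
`exp[−½⟨A′,(C^{(k)})⁻¹A′⟩ − ½⟨φ′,(C^{(k)}(B^{(k+1)}))⁻¹φ′⟩]` under the new integral. [cite: Balaban1982Higgs1, (3.51) p.621] -/
theorem integral_gauss_translate₂ {cA : ℝ} {CA : E →ₗ[ℝ] E} {QsA : U →ₗ[ℝ] E} {qAB : E → U → ℝ} {qB : U → ℝ}
    {qA' : E → ℝ} (hA : Split311 cA CA QsA qAB qB qA') {cφ : ℝ} {Cφ : F →ₗ[ℝ] F} {Qsφ : W →ₗ[ℝ] F}
    {qφψ : F → W → ℝ} {qψ : W → ℝ} {qφ' : F → ℝ} (hφ : Split311 cφ Cφ Qsφ qφψ qψ qφ') (B : U) (ψ : W)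
    (G : E → F → ℝ) :
    ∫ A, Real.exp (-qAB A B) * ∫ φ, Real.exp (-qφψ φ ψ) * G A φ ∂ν ∂μ
      = Real.exp (-qB B) * Real.exp (-qψ ψ) *
        ∫ A', Real.exp (-qA' A') * ∫ φ', Real.exp (-qφ' φ')
          * G (transl310 cA CA QsA A' B) (transl310 cφ Cφ Qsφ φ' ψ) ∂ν ∂μ := by
  -- inner translation, for each `A`
  have hin : ∀ A, ∫ φ, Real.exp (-qφψ φ ψ) * G A φ ∂ν
      = Real.exp (-qψ ψ) * ∫ φ', Real.exp (-qφ' φ') * G A (transl310 cφ Cφ Qsφ φ' ψ) ∂ν :=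
    fun A => integral_gauss_translate ν hφ ψ (G A)
  simp_rw [hin]
  have hcomm : ∀ A, Real.exp (-qAB A B) * (Real.exp (-qψ ψ)
      * ∫ φ', Real.exp (-qφ' φ') * G A (transl310 cφ Cφ Qsφ φ' ψ) ∂ν)
      = Real.exp (-qψ ψ) * (Real.exp (-qAB A B)
        * ∫ φ', Real.exp (-qφ' φ') * G A (transl310 cφ Cφ Qsφ φ' ψ) ∂ν) := fun A => by ring
  simp_rw [hcomm]
  rw [integral_const_mul, integral_gauss_translate μ hA B
    (fun A => ∫ φ', Real.exp (-qφ' φ') * G A (transl310 cφ Cφ Qsφ φ' ψ) ∂ν)]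
  ring

/-- **(3.38) ⇒ (3.51) p. 621**: after the two translations, the characteristic functions `χ(A′)` (3.43) and `χ(φ′)` (3.50)
(`0 ≤ χ ≤ 1`) are inserted against the non-negative integrand, and a common prefactor `K ≥ 0` (↤ `const·χ_{k+1}(B)χ_{k+1}(ψ)`)
multiplies both sides: `K·e^{−qB(B)}e^{−qψ(ψ)}·∫dA′ χ(A′)e^{−qA′(A′)}∫dφ′ χ(φ′)e^{−qφ′(φ′)}G(A′ + …B, φ′ + …ψ) ≤ K·∫dA e^{−qAB(A,B)}
∫dφ e^{−qφψ(φ,ψ)}G(A,φ)` — the shape of *"(3.38) ≥ const … exp(−½⟨B,ΔB⟩ − ½⟨ψ,Δ(B)ψ⟩)χ_{k+1}(B)χ_{k+1}(ψ)∫dA′∫dφ′ …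
χ(A′)χ(φ′)exp[−½⟨A′,(C^{(k)})⁻¹A′⟩ − ½⟨φ′,(C^{(k)}(B^{(k+1)}))⁻¹φ′⟩ + …]"* with the rest of the exponent inside `G ≥ 0`
(integrability of the translated integrands assumed). [cite: Balaban1982Higgs1, (3.51) p.621] -/
theorem ineq351 {cA : ℝ} {CA : E →ₗ[ℝ] E} {QsA : U →ₗ[ℝ] E} {qAB : E → U → ℝ} {qB : U → ℝ} {qA' : E → ℝ}
    (hA : Split311 cA CA QsA qAB qB qA') {cφ : ℝ} {Cφ : F →ₗ[ℝ] F} {Qsφ : W →ₗ[ℝ] F} {qφψ : F → W → ℝ}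
    {qψ : W → ℝ} {qφ' : F → ℝ} (hφ : Split311 cφ Cφ Qsφ qφψ qψ qφ') (B : U) (ψ : W) {K : ℝ} (hK : 0 ≤ K)
    {G : E → F → ℝ} (hG : ∀ A φ, 0 ≤ G A φ) {χA : E → ℝ} (hχA0 : ∀ A, 0 ≤ χA A) (hχA1 : ∀ A, χA A ≤ 1)
    {χφ : F → ℝ} (hχφ0 : ∀ φ, 0 ≤ χφ φ) (hχφ1 : ∀ φ, χφ φ ≤ 1)
    (hintφ : ∀ A', Integrable (fun φ' => Real.exp (-qφ' φ')
      * G (transl310 cA CA QsA A' B) (transl310 cφ Cφ Qsφ φ' ψ)) ν)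
    (hintA : Integrable (fun A' => Real.exp (-qA' A') * ∫ φ', Real.exp (-qφ' φ')
      * G (transl310 cA CA QsA A' B) (transl310 cφ Cφ Qsφ φ' ψ) ∂ν) μ) :
    K * (Real.exp (-qB B) * Real.exp (-qψ ψ) *
        ∫ A', χA A' * (Real.exp (-qA' A') * ∫ φ', χφ φ' * (Real.exp (-qφ' φ')
          * G (transl310 cA CA QsA A' B) (transl310 cφ Cφ Qsφ φ' ψ)) ∂ν) ∂μ)
      ≤ K * ∫ A, Real.exp (-qAB A B) * ∫ φ, Real.exp (-qφψ φ ψ) * G A φ ∂ν ∂μ := by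
  rw [integral_gauss_translate₂ μ ν hA hφ B ψ G]
  refine mul_le_mul_of_nonneg_left (mul_le_mul_of_nonneg_left ?_ (by positivity)) hK
  -- compare the two `dA′` integrals pointwise
  have hinner0 : ∀ A', 0 ≤ ∫ φ', χφ φ' * (Real.exp (-qφ' φ')
      * G (transl310 cA CA QsA A' B) (transl310 cφ Cφ Qsφ φ' ψ)) ∂ν :=
    fun A' => integral_nonneg fun φ' => mul_nonneg (hχφ0 _) (mul_nonneg (Real.exp_nonneg _) (hG _ _))
  have hinner : ∀ A', ∫ φ', χφ φ' * (Real.exp (-qφ' φ')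
      * G (transl310 cA CA QsA A' B) (transl310 cφ Cφ Qsφ φ' ψ)) ∂ν
      ≤ ∫ φ', Real.exp (-qφ' φ') * G (transl310 cA CA QsA A' B) (transl310 cφ Cφ Qsφ φ' ψ) ∂ν :=
    fun A' => integral_insert_cutoff_le ν (hintφ A') (fun φ' => mul_nonneg (Real.exp_nonneg _) (hG _ _)) hχφ0 hχφ1
  refine integral_mono_of_nonneg (Filter.Eventually.of_forall fun A' =>
    mul_nonneg (hχA0 _) (mul_nonneg (Real.exp_nonneg _) (hinner0 A'))) hintA
    (Filter.Eventually.of_forall fun A' => ?_)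
  calc χA A' * (Real.exp (-qA' A') * ∫ φ', χφ φ' * (Real.exp (-qφ' φ')
          * G (transl310 cA CA QsA A' B) (transl310 cφ Cφ Qsφ φ' ψ)) ∂ν)
      ≤ Real.exp (-qA' A') * ∫ φ', χφ φ' * (Real.exp (-qφ' φ')
          * G (transl310 cA CA QsA A' B) (transl310 cφ Cφ Qsφ φ' ψ)) ∂ν :=
        mul_le_of_le_one_left (mul_nonneg (Real.exp_nonneg _) (hinner0 A')) (hχA1 A')
    _ ≤ Real.exp (-qA' A') * ∫ φ', Real.exp (-qφ' φ')
          * G (transl310 cA CA QsA A' B) (transl310 cφ Cφ Qsφ φ' ψ) ∂ν :=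
        mul_le_mul_of_nonneg_left (hinner A') (Real.exp_nonneg _)

end TwoFields

/-! ## §3 The concrete field spaces: Lebesgue measure on `X → ℝ^N` is translation invariant -/

/-- The hypotheses of §§1–2 are met by the field spaces of the paper: on `X → V` (`X` ↤ the finite lattice `T₁^{(k)}`, `V` ↤
`ℝ^N` a finite-dimensional real inner-product space with its Lebesgue measure) the product Lebesgue measure `dA = Π_x dA(x)`
is translation invariant, so e.g. the change of variables (3.41) holds for it verbatim.
[cite: Balaban1982Higgs1, (3.41) p.619] -/
theorem integral_comp_transl310_volume {X U V : Type*} [Fintype X] [AddCommGroup U] [Module ℝ U]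
    [NormedAddCommGroup V] [InnerProductSpace ℝ V] [FiniteDimensional ℝ V] [MeasurableSpace V] [BorelSpace V]
    (c : ℝ) (C : (X → V) →ₗ[ℝ] (X → V)) (Qstar : U →ₗ[ℝ] (X → V)) (B : U) (F : (X → V) → ℝ) :
    ∫ A', F (transl310 c C Qstar A' B) = ∫ A, F A :=
  integral_comp_transl310 volume c C Qstar B F

end Literature.MathematicalPhysics.QuantumFieldTheory.Balaban1983to89.B1Ineq351Proof
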